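import Mathlib
import Literature.Analysis.Fourier.WirtingerDirichlet

/-!
# Clause 13-J, brick B4/B8: POINCARÉ ON THE BALL — `∫_a^b F² ≤ ((b−a)/π)² ∫_a^b F′²` for `F(a) = F(b) = 0`

Route `FilamentSkeletonRss`, child `Clause13NearStraightL` (stmt-NavierStokesRegularity-23321; typing-agnostic, valid verbatim for the
A1G twin 28296); design of record `filament-plan/DESIGN-NOTE-28296-tenure-g22.md` §5 ("… via Plancherel + the dilation identity for
⟨Y, (τ−c)Y′⟩ + Poincaré on the ball"): ball-supported normal variations (`Y = 0` off `|τ − c| ≤ R`) carry no mass below frequency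
`~1/R` — quantitatively the Dirichlet–Poincaré inequality with the sharp constant `((b−a)/π)²` on an interval `[a, b]`, obtained here from
the tree's `Literature.Analysis.Fourier.integral_sq_le_integral_deriv_sq` (Hardy–Littlewood–Pólya Thm 257 on `(0, π)`) by the affine
change of variables `x = a + ((b−a)/π)θ`.  Stated for real `F` with `F′ = f` continuous on `[a, b]`; for complex `Y` apply it to
`Re Y` and `Im Y` and add.
Lane ns-filament-19175-p1 g14; `--supports stmt-NavierStokesRegularity-23321 --as helper`.
HONEST FRAMING: an elementary inequality attached to a HYPOTHETICAL filament skeleton's linearised operator on the NEGATIVE side of a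
MODEL route; nothing here bears on Navier–Stokes regularity or blow-up.
-/

noncomputable section

open MeasureTheory Real Set intervalIntegral

namespace Summit.NavierStokesRegularity.NavierStokesRegularity.Theorems.MatchedKernel
set_option linter.dupNamespace false

/-- **Dirichlet–Poincaré on `[a, b]` (sharp constant).**  If `F` has derivative `f` on `(a, b)`, `F` is continuous on `[a, b]`, `f` is
continuous on `[a, b]`, and `F(a) = F(b) = 0`, then `∫_a^b F² ≤ ((b−a)/π)²·∫_a^b f²`. [folklore; Hardy–Littlewood–Pólya Thm 257 rescaled] -/
theorem integral_sq_le_sq_mul_integral_deriv_sq {F f : ℝ → ℝ} {a b : ℝ} (hab : a < b)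
    (hF : ∀ x ∈ Ioo a b, HasDerivAt F (f x) x) (hFc : ContinuousOn F (Icc a b)) (hfc : ContinuousOn f (Icc a b))
    (hFa : F a = 0) (hFb : F b = 0) :
    ∫ x in a..b, F x ^ 2 ≤ ((b - a) / π) ^ 2 * ∫ x in a..b, f x ^ 2 := by
  have hπ : 0 < π := Real.pi_pos
  set L : ℝ := (b - a) / π with hL
  have hL0 : 0 < L := div_pos (by linarith) hπ
  have hLπ : a + L * π = b := by rw [hL]; field_simp; ring
  -- the affine map `θ ↦ a + L θ` sends `[0, π]` onto `[a, b]`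
  have hmapIoo : ∀ θ ∈ Ioo 0 π, a + L * θ ∈ Ioo a b := by
    intro θ hθ
    refine ⟨by nlinarith [hθ.1], ?_⟩
    calc a + L * θ < a + L * π := by nlinarith [hθ.2]
      _ = b := hLπ
  have hmapIcc : ∀ θ ∈ Icc 0 π, a + L * θ ∈ Icc a b := by
    intro θ hθ
    refine ⟨by nlinarith [hθ.1], ?_⟩
    calc a + L * θ ≤ a + L * π := by nlinarith [hθ.2]
      _ = b := hLπ
  have haff : Continuous fun θ : ℝ => a + L * θ := by fun_prop
  -- rescaled functions
  set G : ℝ → ℝ := fun θ => F (a + L * θ) with hG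
  set g : ℝ → ℝ := fun θ => L * f (a + L * θ) with hg
  have hGd : ∀ θ ∈ Ioo 0 π, HasDerivAt G (g θ) θ := by
    intro θ hθ
    have h1 : HasDerivAt (fun θ : ℝ => a + L * θ) L θ := by
      simpa using ((hasDerivAt_id θ).const_mul L).const_add a
    have h2 : HasDerivAt (F ∘ fun θ : ℝ => a + L * θ) (f (a + L * θ) * L) θ := (hF _ (hmapIoo θ hθ)).comp θ h1
    have h3 : HasDerivAt G (f (a + L * θ) * L) θ := h2
    exact h3.congr_deriv (by simp only [hg]; ring)
  have hGc : ContinuousOn G (Icc 0 π) := hFc.comp haff.continuousOn hmapIcc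
  have hgc' : ContinuousOn g (Icc 0 π) := continuousOn_const.mul (hfc.comp haff.continuousOn hmapIcc)
  have hgc : ContinuousOn g (Ioo 0 π) := hgc'.mono Ioo_subset_Icc_self
  have hg1 : IntervalIntegrable g volume 0 π := (hgc'.mono (by rw [uIcc_of_le hπ.le])).intervalIntegrable
  have hg2 : IntervalIntegrable (fun θ => g θ ^ 2) volume 0 π :=
    ((hgc'.pow 2).mono (by rw [uIcc_of_le hπ.le])).intervalIntegrable
  have hG0 : G 0 = 0 := by simp [hG, hFa]
  have hGπ : G π = 0 := by simp only [hG]; rw [hLπ, hFb]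
  have hW := Literature.Analysis.Fourier.integral_sq_le_integral_deriv_sq hGd hGc hgc hg1 hg2 hG0 hGπ
  -- change variables back: `∫₀^π F(a+Lθ)² dθ = L⁻¹ ∫_a^b F²`, `∫₀^π g² = L ∫_a^b f²`
  have hcv1 : ∫ θ in (0:ℝ)..π, G θ ^ 2 = L⁻¹ * ∫ x in a..b, F x ^ 2 := by
    have h := intervalIntegral.integral_comp_mul_add (fun x => F x ^ 2) hL0.ne' a (a := 0) (b := π)
    simp only [mul_zero, smul_eq_mul] at h
    rw [show L * π + a = b by linarith [hLπ]] at h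
    simpa [hG, add_comm, mul_comm] using h
  have hcv2 : ∫ θ in (0:ℝ)..π, g θ ^ 2 = L * ∫ x in a..b, f x ^ 2 := by
    have h := intervalIntegral.integral_comp_mul_add (fun x => f x ^ 2) hL0.ne' a (a := 0) (b := π)
    simp only [mul_zero, smul_eq_mul] at h
    rw [show L * π + a = b by linarith [hLπ]] at h
    have h2 : ∫ θ in (0:ℝ)..π, g θ ^ 2 = L ^ 2 * ∫ θ in (0:ℝ)..π, f (a + L * θ) ^ 2 := by
      rw [← intervalIntegral.integral_const_mul]
      refine intervalIntegral.integral_congr fun θ _ => ?_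
      simp only [hg]; ring
    rw [h2]
    have h3 : ∫ θ in (0:ℝ)..π, f (a + L * θ) ^ 2 = L⁻¹ * ∫ x in a..b, f x ^ 2 := by
      simpa [add_comm, mul_comm] using h
    rw [h3]; field_simp
  rw [hcv1, hcv2] at hW
  -- `L⁻¹ ∫F² ≤ L ∫f²` ⇒ `∫F² ≤ L² ∫f²`
  have h := mul_le_mul_of_nonneg_left hW hL0.le
  rw [← mul_assoc, mul_inv_cancel₀ hL0.ne', one_mul, ← mul_assoc, ← sq] at h
  exact h

end Summit.NavierStokesRegularity.NavierStokesRegularity.Theorems.MatchedKernel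

end
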